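import Mathlib
import HarnessLib
import Summits.ResolutionOfSingularities.ResolutionOfSingularities.Theorems.WildQuotientsWildQuotientResolutionS1aKillLeafPolynomial

/-!
# S1a — KC4′: JORDAN CHAINS OF LENGTH 3 KILL WITH WEIGHTS (3,2,1); the Jordan block `J₄` (`JordanBlockFourfold`'s node) is killed in ONE move

[OURS · L1 W4.5c · lead-1 g10; beyond SUCCESSOR-BRIEF v1.3 — the kill criterion applied to the route's FIRST RUNG `JordanBlockFourfold`
(stmt-ResolutionOfSingularities-17942)] — NOT statements of the manuscript; counted 0; AI-level work, weaker than expert review. Crux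
stmt-ResolutionOfSingularities-17941 `CyclicQuotientFourfolds`, line `s1a-logminvertex` v10, K-side (`stub_killTouchReachAux`).

* `sigmaR_sub_eq_of_step` — the generic increment computation in `R^w`: if `σ y − y = β h y′ + β j` with `y = sⁿ·z`, `y′ = sⁿ⁺¹ z′`, `j = sⁿ⁺² z″`
  then `σ_R z − z = β s · (h z′ + s z″)`;
* ★ **KC4′** `irrelevant_of_jordanChainThree` — centre `(x₁, x₂, x₃) = (f 0, f 1, f 2)` with weights `(3, 2, 1)`, an element `x₄`, units `h₁ h₂ h₃`:
  `σ x₂ − x₂ − β h₁ x₁ ∈ β 𝒥₄`, `σ x₃ − x₃ − β h₂ x₂ ∈ β 𝒥₃`, `σ x₄ − x₄ − β h₃ x₃ ∈ β 𝒥₂` (`in θ(x_{i+1}) = h̄ᵢ x̄ᵢʼ`) ⇒ hypothesis (i) of KC3 with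
  `N = 1` (indeed `vertexIdeal ≤ 𝔞 ⊔ (s)`); `cobordantKillCert_jordanChainThree` (KC3∘KC4′), ★★ `ringKillData_jordanChainThree` (KC2∘KC3∘KC4′, (a′)
  checked on generators);
* ★★★ `ringKillData_jordanBlockFour` — `B = k[x₀, x₁, x₂, x₃]` (any field, any trivial grading), `σ` ANY ring automorphism fixing constants and `x₀`
  with `σ x_{i+1} = x_{i+1} + x_i` (the unipotent Jordan block `J₄ = V₄`; order `p` in characteristic `p ≥ 5` — the JordanBlockFourfold datum): the
  (3,2,1)-weighted cobordant blow-up of the FIXED AXIS `V(x₀, x₁, x₂)` KILLS — `RingKillData p r B 𝒜 σ` for every `p`: upstairs the increments are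
  `s·x₀ʼ, s·x₁ʼ, s·x₂ʼ`, so the augmentation ideal of `σʼ` is `(s)` on every σ-fixed chart `d' > 0`. (`exists_jordanAut`: non-vacuity.)
  Reading: `𝔸⁴/V₄` (p ≥ 5) is resolved by ONE weighted blow-up followed by the DOOR (tame `μ₂, μ₃`-quotient singularities of the weighted blow-up).
-/

set_option linter.dupNamespace false

noncomputable section

open Literature.AlgebraicGeometry.Resolution
open scoped LaurentPolynomial
open MvPolynomial
open Summit.ResolutionOfSingularities.ResolutionOfSingularities.Theorems.WildQuotientResolution.S1.CoarseChart
open Summit.ResolutionOfSingularities.ResolutionOfSingularities.Theorems.WildQuotientResolution.S1.BlowupCharts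

namespace Summit.ResolutionOfSingularities.ResolutionOfSingularities.Theorems.WildQuotientResolution.S1.KillCert

universe u

section Chain

variable {B : Type u} [CommRing B] {c : ℕ} (f : Fin c → B) (w : Fin c → ℕ) (σ : B ≃+* B)
  (hσJ : ∀ n : ℕ, ((weightedFiltration f w).ideal n).map (σ : B →+* B) ≤ (weightedFiltration f w).ideal n)
  {p : ℕ} (hp : 0 < p) (hσp : ∀ x : B, (⇑σ)^[p] x = x)

/-- **The generic increment computation.** If `σ y − y = β h y′ + β j` in `B` and, in `R^w`, `z sⁿ = y`, `y′ = sⁿ⁺¹ z′`, `j = sⁿ⁺² z″`, then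
`(h z′ + s z″) · (β s) = σ_R z − z` (cancel the non-zero-divisor `sⁿ`). [OURS · L1 W4.5c] -/
theorem sigmaR_sub_eq_of_step (β h : B) {n : ℕ} {y y' j : B} (hy : σ y - y = β * h * y' + β * j)
    (z z' z'' : ↥(cobordantAlgebra f w)) (hz : z * cobordantAlgebra.s f w ^ n = algebraMap B _ y)
    (hz' : algebraMap B (↥(cobordantAlgebra f w)) y' = cobordantAlgebra.s f w ^ (n + 1) * z')
    (hz'' : algebraMap B (↥(cobordantAlgebra f w)) j = cobordantAlgebra.s f w ^ (n + 2) * z'') :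
    (algebraMap B _ h * z' + cobordantAlgebra.s f w * z'') * (algebraMap B (↥(cobordantAlgebra f w)) β * cobordantAlgebra.s f w) =
      sigmaR σ f w hσJ hp hσp z - z := by
  rw [← mul_cancel_right_mem_nonZeroDivisors (s_pow_mem_nonZeroDivisors f w n), sub_mul]
  have h3 : sigmaR σ f w hσJ hp hσp z * cobordantAlgebra.s f w ^ n = algebraMap B (↥(cobordantAlgebra f w)) (σ y) := by
    rw [← sigmaR_algebraMap σ f w hσJ hp hσp, ← hz, map_mul, sigmaR_s_pow]
  rw [h3, hz, ← map_sub, hy, map_add, map_mul, map_mul, map_mul, hz', hz'']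
  ring

/-- ★ **KC4′ — JORDAN CHAINS OF LENGTH 3.** Centre `f = (x₁, x₂, x₃)` with weights `(3, 2, 1)`, an element `x₄`, units `h₁ h₂ h₃ : B` and the chain
data `σ x₂ − x₂ − β h₁ x₁ ∈ β 𝒥₄`, `σ x₃ − x₃ − β h₂ x₂ ∈ β 𝒥₃`, `σ x₄ − x₄ − β h₃ x₃ ∈ β 𝒥₂` (`in θ(x_{i+1}) = h̄ᵢ·x̄ᵢʼ`). Then hypothesis (i) of KC3
holds with `N = 1`: `σ_R x₂ʼ − x₂ʼ = βs (h₁ x₁ʼ + s·j₄t⁴)`, `σ_R x₃ʼ − x₃ʼ = βs (h₂ x₂ʼ + s·j₃t³)`, `σ_R x₄ − x₄ = βs (h₃ x₃ʼ + s·j₂t²)`.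
[OURS · L1 W4.5c; NOT a statement of the manuscript] -/
theorem irrelevant_of_jordanChainThree (f : Fin 3 → B) (β x₄ h₁ h₂ h₃ : B) (hh₁ : IsUnit h₁) (hh₂ : IsUnit h₂) (hh₃ : IsUnit h₃)
    (hσJ : ∀ n : ℕ, ((weightedFiltration f ![3, 2, 1]).ideal n).map (σ : B →+* B) ≤ (weightedFiltration f ![3, 2, 1]).ideal n)
    (c₂ : σ (f 1) - f 1 - β * h₁ * f 0 ∈ Ideal.span {β} * (weightedFiltration f ![3, 2, 1]).ideal 4)
    (c₃ : σ (f 2) - f 2 - β * h₂ * f 1 ∈ Ideal.span {β} * (weightedFiltration f ![3, 2, 1]).ideal 3)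
    (c₄ : σ x₄ - x₄ - β * h₃ * f 2 ∈ Ideal.span {β} * (weightedFiltration f ![3, 2, 1]).ideal 2) :
    cobordantAlgebra.vertexIdeal f ![3, 2, 1] ≤
      (augmentationIdeal (sigmaR σ f ![3, 2, 1] hσJ hp hσp)).colon
          (Ideal.span {algebraMap B (↥(cobordantAlgebra f ![3, 2, 1])) β * cobordantAlgebra.s f ![3, 2, 1]}) ⊔
        cobordantAlgebra.excIdeal f ![3, 2, 1] := by
  obtain ⟨j₄, hj₄, e₄⟩ := Ideal.mem_span_singleton_mul.mp c₂
  obtain ⟨j₃, hj₃, e₃⟩ := Ideal.mem_span_singleton_mul.mp c₃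
  obtain ⟨j₂, hj₂, e₂⟩ := Ideal.mem_span_singleton_mul.mp c₄
  have hw0 : (![3, 2, 1] : Fin 3 → ℕ) 0 = 3 := rfl
  have hw1 : (![3, 2, 1] : Fin 3 → ℕ) 1 = 2 := rfl
  have hw2 : (![3, 2, 1] : Fin 3 → ℕ) 2 = 1 := rfl
  -- `x_i = s^{w_i} x_iʼ`, `j_n = s^n (j_n tⁿ)`
  have hx : ∀ i : Fin 3, cobordantAlgebra.u' f ![3, 2, 1] i * cobordantAlgebra.s f ![3, 2, 1] ^ ((![3, 2, 1] : Fin 3 → ℕ) i) =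
      algebraMap B (↥(cobordantAlgebra f ![3, 2, 1])) (f i) := fun i => by
    rw [cobordantAlgebra.algebraMap_u, mul_comm]
  have hx' : ∀ i : Fin 3, algebraMap B (↥(cobordantAlgebra f ![3, 2, 1])) (f i) =
      cobordantAlgebra.s f ![3, 2, 1] ^ ((![3, 2, 1] : Fin 3 → ℕ) i) * cobordantAlgebra.u' f ![3, 2, 1] i := fun i =>
    cobordantAlgebra.algebraMap_u f ![3, 2, 1] i
  have hz₄ := algebraMap_eq_s_pow_mul f ![3, 2, 1] ⟨_, C_mul_T_mem_cobordantAlgebra f ![3, 2, 1] hj₄⟩ rfl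
  have hz₃ := algebraMap_eq_s_pow_mul f ![3, 2, 1] ⟨_, C_mul_T_mem_cobordantAlgebra f ![3, 2, 1] hj₃⟩ rfl
  have hz₂ := algebraMap_eq_s_pow_mul f ![3, 2, 1] ⟨_, C_mul_T_mem_cobordantAlgebra f ![3, 2, 1] hj₂⟩ rfl
  -- the three memberships
  have m0 : cobordantAlgebra.u' f ![3, 2, 1] 0 ∈
      (augmentationIdeal (sigmaR σ f ![3, 2, 1] hσJ hp hσp)).colon
          (Ideal.span {algebraMap B (↥(cobordantAlgebra f ![3, 2, 1])) β * cobordantAlgebra.s f ![3, 2, 1]}) ⊔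
        cobordantAlgebra.excIdeal f ![3, 2, 1] := by
    refine mem_colon_sup_excIdeal_of_unit f ![3, 2, 1] (hh₁.map (algebraMap B (↥(cobordantAlgebra f ![3, 2, 1]))))
      (z := ⟨_, C_mul_T_mem_cobordantAlgebra f ![3, 2, 1] hj₄⟩) ?_
    rw [sigmaR_sub_eq_of_step f ![3, 2, 1] σ hσJ hp hσp β h₁ (y := f 1) (y' := f 0) (j := j₄) (n := 2) (by rw [e₄]; ring)
      (cobordantAlgebra.u' f ![3, 2, 1] 1) (cobordantAlgebra.u' f ![3, 2, 1] 0) ⟨_, C_mul_T_mem_cobordantAlgebra f ![3, 2, 1] hj₄⟩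
      (by rw [← hx 1, hw1]) (by rw [hx' 0, hw0]) hz₄]
    exact sub_mem_augmentationIdeal _ _
  have m1 : cobordantAlgebra.u' f ![3, 2, 1] 1 ∈
      (augmentationIdeal (sigmaR σ f ![3, 2, 1] hσJ hp hσp)).colon
          (Ideal.span {algebraMap B (↥(cobordantAlgebra f ![3, 2, 1])) β * cobordantAlgebra.s f ![3, 2, 1]}) ⊔
        cobordantAlgebra.excIdeal f ![3, 2, 1] := by
    refine mem_colon_sup_excIdeal_of_unit f ![3, 2, 1] (hh₂.map (algebraMap B (↥(cobordantAlgebra f ![3, 2, 1]))))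
      (z := ⟨_, C_mul_T_mem_cobordantAlgebra f ![3, 2, 1] hj₃⟩) ?_
    rw [sigmaR_sub_eq_of_step f ![3, 2, 1] σ hσJ hp hσp β h₂ (y := f 2) (y' := f 1) (j := j₃) (n := 1) (by rw [e₃]; ring)
      (cobordantAlgebra.u' f ![3, 2, 1] 2) (cobordantAlgebra.u' f ![3, 2, 1] 1) ⟨_, C_mul_T_mem_cobordantAlgebra f ![3, 2, 1] hj₃⟩
      (by rw [← hx 2, hw2]) (by rw [hx' 1, hw1]) hz₃]
    exact sub_mem_augmentationIdeal _ _
  have m2 : cobordantAlgebra.u' f ![3, 2, 1] 2 ∈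
      (augmentationIdeal (sigmaR σ f ![3, 2, 1] hσJ hp hσp)).colon
          (Ideal.span {algebraMap B (↥(cobordantAlgebra f ![3, 2, 1])) β * cobordantAlgebra.s f ![3, 2, 1]}) ⊔
        cobordantAlgebra.excIdeal f ![3, 2, 1] := by
    refine mem_colon_sup_excIdeal_of_unit f ![3, 2, 1] (hh₃.map (algebraMap B (↥(cobordantAlgebra f ![3, 2, 1]))))
      (z := ⟨_, C_mul_T_mem_cobordantAlgebra f ![3, 2, 1] hj₂⟩) ?_
    rw [sigmaR_sub_eq_of_step f ![3, 2, 1] σ hσJ hp hσp β h₃ (y := x₄) (y' := f 2) (j := j₂) (n := 0) (by rw [e₂]; ring)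
      (algebraMap B _ x₄) (cobordantAlgebra.u' f ![3, 2, 1] 2) ⟨_, C_mul_T_mem_cobordantAlgebra f ![3, 2, 1] hj₂⟩
      (by rw [pow_zero, mul_one]) (by rw [hx' 2, hw2]) hz₂]
    exact sub_mem_augmentationIdeal _ _
  rw [cobordantAlgebra.vertexIdeal, Ideal.span_le]
  rintro _ ⟨i, rfl⟩
  fin_cases i
  exacts [m0, m1, m2]

/-- **KC3 ∘ KC4′**: boundary-admissibility, isolation and the length-3 chain data give the cobordant kill certificate `β s`. [OURS · L1 W4.5c] -/
theorem cobordantKillCert_jordanChainThree (f : Fin 3 → B) (β x₄ h₁ h₂ h₃ : B) (hh₁ : IsUnit h₁) (hh₂ : IsUnit h₂) (hh₃ : IsUnit h₃)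
    (hσJ : ∀ n : ℕ, ((weightedFiltration f ![3, 2, 1]).ideal n).map (σ : B →+* B) ≤ (weightedFiltration f ![3, 2, 1]).ideal n)
    (hadm : ∀ (n : ℕ) (y : B), y ∈ (weightedFiltration f ![3, 2, 1]).ideal n →
      σ y - y ∈ Ideal.span {β} * (weightedFiltration f ![3, 2, 1]).ideal (n + 1))
    (hiso : ∃ N : ℕ, Ideal.span (Set.range f) ^ N ≤ (augmentationIdeal σ).colon (Ideal.span {β}))
    (c₂ : σ (f 1) - f 1 - β * h₁ * f 0 ∈ Ideal.span {β} * (weightedFiltration f ![3, 2, 1]).ideal 4)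
    (c₃ : σ (f 2) - f 2 - β * h₂ * f 1 ∈ Ideal.span {β} * (weightedFiltration f ![3, 2, 1]).ideal 3)
    (c₄ : σ x₄ - x₄ - β * h₃ * f 2 ∈ Ideal.span {β} * (weightedFiltration f ![3, 2, 1]).ideal 2) :
    CobordantKillCert f ![3, 2, 1] σ hσJ hp hσp
      (algebraMap B (↥(cobordantAlgebra f ![3, 2, 1])) β * cobordantAlgebra.s f ![3, 2, 1]) :=
  cobordantKillCert_of_admissible_of_irrelevant f ![3, 2, 1] σ hσJ hp hσp β hadm hiso
    ⟨1, by rw [pow_one]; exact irrelevant_of_jordanChainThree σ hp hσp f β x₄ h₁ h₂ h₃ hh₁ hh₂ hh₃ hσJ c₂ c₃ c₄⟩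

end Chain

section Node

variable {p : ℕ} {m : ℕ} (r : Fin m → ℕ) (B : Type u) [CommRing B] (𝒜 : (Π j : Fin m, ZMod (r j)) → AddSubgroup B)
  [GradedRing 𝒜] (σ : B ≃+* B)

/-- ★★ **KC2 ∘ KC3 ∘ KC4′ — THE TYPED JORDAN-CHAIN KILL.** In any node `(B, 𝒜, σ)`: a homogeneous K1′-regular centre `(x₁, x₂, x₃) = (f 0, f 1, f 2)`
with weights `(3, 2, 1)` and a Veronese degree; a boundary element `β` with (a′) checked on a generating set `G` (`σ g − g ∈ β 𝒥₁`) and on the centre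
(`σ x₁ − x₁ ∈ β 𝒥₄`; the chain data give the rest); isolation `(x₁, x₂, x₃)^N ≤ (augIdeal σ : β)`; the chain data with units `h₁ h₂ h₃`. Then
`RingKillData p r B 𝒜 σ`, for every `p`. [OURS · L1 W4.5c; NOT a statement of the manuscript] -/
theorem ringKillData_jordanChainThree (f : Fin 3 → B) (δ : Fin 3 → Π j : Fin m, ZMod (r j)) (d : ℕ)
    (hf : ∀ i, f i ∈ 𝒜 (δ i))
    (hK1 : RingTheory.Sequence.IsRegular B (List.ofFn f)) (hK1' : IsRegularRing (B ⧸ Ideal.span (Set.range f)))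
    (hver : VeroneseNormalised 𝒜 f ![3, 2, 1] d) (β x₄ h₁ h₂ h₃ : B) (hh₁ : IsUnit h₁) (hh₂ : IsUnit h₂) (hh₃ : IsUnit h₃)
    (G : Set B) (hG : Subring.closure G = ⊤)
    (h0 : ∀ g ∈ G, σ g - g ∈ Ideal.span {β} * (weightedFiltration f ![3, 2, 1]).ideal 1)
    (c₁ : σ (f 0) - f 0 ∈ Ideal.span {β} * (weightedFiltration f ![3, 2, 1]).ideal 4)
    (hiso : ∃ N : ℕ, Ideal.span (Set.range f) ^ N ≤ (augmentationIdeal σ).colon (Ideal.span {β}))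
    (c₂ : σ (f 1) - f 1 - β * h₁ * f 0 ∈ Ideal.span {β} * (weightedFiltration f ![3, 2, 1]).ideal 4)
    (c₃ : σ (f 2) - f 2 - β * h₂ * f 1 ∈ Ideal.span {β} * (weightedFiltration f ![3, 2, 1]).ideal 3)
    (c₄ : σ x₄ - x₄ - β * h₃ * f 2 ∈ Ideal.span {β} * (weightedFiltration f ![3, 2, 1]).ideal 2) :
    RingKillData p r B 𝒜 σ := by
  -- (a′) on the centre from the chain data
  have h₂' : σ (f 1) - f 1 ∈ Ideal.span {β} * (weightedFiltration f ![3, 2, 1]).ideal 3 := by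
    have hx : β * h₁ * f 0 ∈ Ideal.span {β} * (weightedFiltration f ![3, 2, 1]).ideal 3 := by
      rw [mul_assoc]
      exact Ideal.mul_mem_mul (Ideal.mem_span_singleton_self β) (Ideal.mul_mem_left _ h₁ (mem_weightedFiltration_ideal f ![3, 2, 1] 0))
    have := Ideal.add_mem _ (Ideal.mul_mono_right ((weightedFiltration f ![3, 2, 1]).antitone (by norm_num : 3 ≤ 4)) c₂) hx
    rwa [sub_add_cancel] at this
  have h₃' : σ (f 2) - f 2 ∈ Ideal.span {β} * (weightedFiltration f ![3, 2, 1]).ideal 2 := by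
    have hx : β * h₂ * f 1 ∈ Ideal.span {β} * (weightedFiltration f ![3, 2, 1]).ideal 2 := by
      rw [mul_assoc]
      exact Ideal.mul_mem_mul (Ideal.mem_span_singleton_self β) (Ideal.mul_mem_left _ h₂ (mem_weightedFiltration_ideal f ![3, 2, 1] 1))
    have := Ideal.add_mem _ (Ideal.mul_mono_right ((weightedFiltration f ![3, 2, 1]).antitone (by norm_num : 2 ≤ 3)) c₃) hx
    rwa [sub_add_cancel] at this
  have hfw : ∀ i : Fin 3, σ (f i) - f i ∈ Ideal.span {β} * (weightedFiltration f ![3, 2, 1]).ideal ((![3, 2, 1] : Fin 3 → ℕ) i + 1) := by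
    intro i
    fin_cases i
    exacts [c₁, h₂', h₃']
  have hadm := admissible_of_generators f ![3, 2, 1] σ β G hG h0 hfw
  exact ringKillData_of_cert r B 𝒜 σ f δ ![3, 2, 1] d (by norm_num) hf (fun i => by fin_cases i <;> norm_num) hK1 hK1'
    (map_le_of_admissible f ![3, 2, 1] σ β hadm) hver fun hp hσp =>
      ⟨_, cobordantKillCert_jordanChainThree σ hp hσp f β x₄ h₁ h₂ h₃ hh₁ hh₂ hh₃ (map_le_of_admissible f ![3, 2, 1] σ β hadm)
        hadm hiso c₂ c₃ c₄⟩

end Node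

/-! ## The Jordan block `J₄` on `𝔸⁴` -/

section JordanFour

variable (k : Type) [Field k]

/-- **The Jordan block exists**: `x₀ ↦ x₀`, `x_{i+1} ↦ x_{i+1} + x_i` extends to a `k`-algebra automorphism of `k[x₀..x₃]`. [OURS · L1 W4.5c] -/
theorem exists_jordanAut :
    ∃ σ : MvPolynomial (Fin 4) k ≃+* MvPolynomial (Fin 4) k, (∀ a : k, σ (C a) = C a) ∧
      σ (X 0) = X 0 ∧ σ (X 1) = X 1 + X 0 ∧ σ (X 2) = X 2 + X 1 ∧ σ (X 3) = X 3 + X 2 := by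
  let φ : MvPolynomial (Fin 4) k →ₐ[k] MvPolynomial (Fin 4) k := aeval ![X 0, X 1 + X 0, X 2 + X 1, X 3 + X 2]
  let ψ : MvPolynomial (Fin 4) k →ₐ[k] MvPolynomial (Fin 4) k :=
    aeval ![X 0, X 1 - X 0, X 2 - X 1 + X 0, X 3 - X 2 + X 1 - X 0]
  have hφ : ∀ i, φ (X i) = (![X 0, X 1 + X 0, X 2 + X 1, X 3 + X 2] : Fin 4 → MvPolynomial (Fin 4) k) i :=
    fun i => aeval_X _ i
  have hψ : ∀ i, ψ (X i) = (![X 0, X 1 - X 0, X 2 - X 1 + X 0, X 3 - X 2 + X 1 - X 0] : Fin 4 → MvPolynomial (Fin 4) k) i :=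
    fun i => aeval_X _ i
  have h1 : φ.comp ψ = AlgHom.id k _ := by
    refine algHom_ext fun i => ?_
    rw [AlgHom.comp_apply, AlgHom.id_apply]
    fin_cases i <;>
      simp only [hψ, Fin.zero_eta, Fin.mk_one, Fin.reduceFinMk, Matrix.cons_val_zero, Matrix.cons_val_one, Matrix.cons_val,
        map_sub, map_add, hφ] <;> ring
  have h2 : ψ.comp φ = AlgHom.id k _ := by
    refine algHom_ext fun i => ?_
    rw [AlgHom.comp_apply, AlgHom.id_apply]
    fin_cases i <;>
      simp only [hφ, Fin.zero_eta, Fin.mk_one, Fin.reduceFinMk, Matrix.cons_val_zero, Matrix.cons_val_one, Matrix.cons_val,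
        map_add, hψ] <;> ring
  refine ⟨(AlgEquiv.ofAlgHom φ ψ h1 h2).toRingEquiv, fun a => ?_, ?_, ?_, ?_, ?_⟩
  · exact φ.commutes a
  all_goals
    change φ (X _) = _
    rw [hφ]
    simp

/-- `(x₀, x₁, x₂)` is a regular sequence on `k[x₀..x₃]`. [OURS · L1 W4.5c] -/
theorem isRegular_X_zero_X_one_X_two :
    RingTheory.Sequence.IsRegular (MvPolynomial (Fin 4) k) (List.ofFn (![X 0, X 1, X 2] : Fin 3 → MvPolynomial (Fin 4) k)) := by
  have hl : List.ofFn (![X 0, X 1, X 2] : Fin 3 → MvPolynomial (Fin 4) k) = ([0, 1, 2] : List (Fin 4)).map X := by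
    simp [List.ofFn_succ]
  rw [hl]
  refine ⟨isWeaklyRegular_map_X (R := k) [0, 1, 2] (by decide), ?_⟩
  intro htop
  rw [smul_eq_mul, Ideal.mul_top] at htop
  have h1 : (1 : MvPolynomial (Fin 4) k) ∈ Ideal.ofList (([0, 1, 2] : List (Fin 4)).map (X : Fin 4 → MvPolynomial (Fin 4) k)) := by
    rw [← htop]; trivial
  have hle : Ideal.ofList (([0, 1, 2] : List (Fin 4)).map (X : Fin 4 → MvPolynomial (Fin 4) k)) ≤
      RingHom.ker (constantCoeff : MvPolynomial (Fin 4) k →+* k) := by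
    rw [Ideal.ofList, Ideal.span_le]
    intro x hx
    simp only [List.map_cons, List.map_nil, List.mem_cons, List.not_mem_nil, or_false, Set.mem_setOf_eq] at hx
    rcases hx with rfl | rfl | rfl <;> simp [RingHom.mem_ker, constantCoeff_X]
  have := hle h1
  rw [RingHom.mem_ker, map_one] at this
  exact one_ne_zero this

/-- `Set.range ![x₀, x₁, x₂] = X '' {0, 1, 2}`. -/
theorem range_X_zero_X_one_X_two :
    Set.range (![X 0, X 1, X 2] : Fin 3 → MvPolynomial (Fin 4) k) = X '' ({0, 1, 2} : Set (Fin 4)) := by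
  ext x
  simp only [Set.mem_range, Set.mem_image, Set.mem_insert_iff, Set.mem_singleton_iff]
  constructor
  · rintro ⟨i, rfl⟩
    fin_cases i
    · exact ⟨0, Or.inl rfl, rfl⟩
    · exact ⟨1, Or.inr (Or.inl rfl), rfl⟩
    · exact ⟨2, Or.inr (Or.inr rfl), rfl⟩
  · rintro ⟨j, rfl | rfl | rfl, rfl⟩
    · exact ⟨0, rfl⟩
    · exact ⟨1, rfl⟩
    · exact ⟨2, rfl⟩

/-- `k[x₀..x₃]/(x₀, x₁, x₂) ≅ k[x₃]` is a regular ring. [OURS · L1 W4.5c] -/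
theorem isRegularRing_quotient_X_zero_X_one_X_two :
    IsRegularRing (MvPolynomial (Fin 4) k ⧸ Ideal.span (Set.range (![X 0, X 1, X 2] : Fin 3 → MvPolynomial (Fin 4) k))) := by
  rw [range_X_zero_X_one_X_two]
  haveI : IsRegularRing (MvPolynomial {j : Fin 4 // j ∉ ({0, 1, 2} : Set (Fin 4))} k) := inferInstance
  exact IsRegularRing.of_ringEquiv (quotientSpanXEquiv (R := k) ({0, 1, 2} : Set (Fin 4))).toRingEquiv.symm

/-- ★★★ **THE JORDAN BLOCK `J₄` IS KILLED BY ONE (3,2,1)-WEIGHTED BLOW-UP OF ITS FIXED AXIS, FOR ALL `p`.** On `B = k[x₀, x₁, x₂, x₃]` with ANY trivial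
grading `𝒜`, let `σ` be a ring automorphism fixing the constants and `x₀` with `σ x_{i+1} = x_{i+1} + x_i` (`i = 0, 1, 2`) — the unipotent Jordan block
`V₄` (of order `p` in characteristic `p ≥ 5`: the `JordanBlockFourfold` datum, stmt-17942). Then `RingKillData p r B 𝒜 σ` with the centre
`(x₀, x₁, x₂)` (the fixed axis), weights `(3, 2, 1)`, `β = 1`: on EVERY σ-fixed chart `R^w[(bT^{d'})⁻¹]`, `d' > 0`, of the weighted cobordant blow-up the
augmentation ideal of `σʼ` is `(s)` — principal. [OURS · L1 W4.5c · the kill criterion on the route's first rung; NOT a statement of the manuscript] -/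
theorem ringKillData_jordanBlockFour (p : ℕ) (r : Fin 0 → ℕ)
    (𝒜 : (Π j : Fin 0, ZMod (r j)) → AddSubgroup (MvPolynomial (Fin 4) k)) [GradedRing 𝒜] (h𝒜 : ∀ i, 𝒜 i = ⊤)
    (σ : MvPolynomial (Fin 4) k ≃+* MvPolynomial (Fin 4) k) (hC : ∀ a : k, σ (C a) = C a)
    (h0 : σ (X 0) = X 0) (h1 : σ (X 1) = X 1 + X 0) (h2 : σ (X 2) = X 2 + X 1) (h3 : σ (X 3) = X 3 + X 2) :
    RingKillData p r (MvPolynomial (Fin 4) k) 𝒜 σ := by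
  classical
  let f : Fin 3 → MvPolynomial (Fin 4) k := ![X 0, X 1, X 2]
  have hf0 : f 0 = X 0 := rfl
  have hf1 : f 1 = X 1 := rfl
  have hf2 : f 2 = X 2 := rfl
  have hf : ∀ i, f i ∈ 𝒜 ((fun _ => 0) i) := fun i => by rw [h𝒜]; trivial
  have hT2 : ∃ t : Finset (MvPolynomial (Fin 4) k),
      Subring.closure (((𝒜 0 : AddSubgroup (MvPolynomial (Fin 4) k)) : Set (MvPolynomial (Fin 4) k)) ∪
        (↑t : Set (MvPolynomial (Fin 4) k))) = ⊤ := by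
    refine ⟨∅, ?_⟩
    rw [h𝒜 0, Finset.coe_empty, Set.union_empty]
    exact top_le_iff.mp fun x _ => Subring.subset_closure trivial
  obtain ⟨d, hver⟩ := Veronese.veroneseNormalisation _ _ 𝒜 hT2 3 f (fun _ => 0) ![3, 2, 1] hf
  -- the increments and their weights
  have hX0 : X 0 ∈ (weightedFiltration f ![3, 2, 1]).ideal 3 := mem_weightedFiltration_ideal f ![3, 2, 1] 0
  have hX1 : X 1 ∈ (weightedFiltration f ![3, 2, 1]).ideal 2 := mem_weightedFiltration_ideal f ![3, 2, 1] 1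
  have hX2 : X 2 ∈ (weightedFiltration f ![3, 2, 1]).ideal 1 := mem_weightedFiltration_ideal f ![3, 2, 1] 2
  have hinc1 : σ (X 1) - X 1 = 1 * X 0 := by rw [h1]; ring
  have hinc2 : σ (X 2) - X 2 = 1 * X 1 := by rw [h2]; ring
  have hinc3 : σ (X 3) - X 3 = 1 * X 2 := by rw [h3]; ring
  have h1J : ∀ {n : ℕ} {y : MvPolynomial (Fin 4) k}, y ∈ (weightedFiltration f ![3, 2, 1]).ideal n →
      1 * y ∈ Ideal.span {(1 : MvPolynomial (Fin 4) k)} * (weightedFiltration f ![3, 2, 1]).ideal n :=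
    fun hy => Ideal.mul_mem_mul (Ideal.mem_span_singleton_self _) hy
  refine ringKillData_jordanChainThree r (MvPolynomial (Fin 4) k) 𝒜 σ f (fun _ => 0) d hf
    (isRegular_X_zero_X_one_X_two k) (isRegularRing_quotient_X_zero_X_one_X_two k) hver 1 (X 3) 1 1 1 isUnit_one isUnit_one isUnit_one
    (Set.range (C : k → MvPolynomial (Fin 4) k) ∪ Set.range (X : Fin 4 → MvPolynomial (Fin 4) k))
    (closure_range_C_union_range_X k) ?_ ?_ ?_ ?_ ?_ ?_
  · -- (a′) on the generators
    rintro g (⟨a, rfl⟩ | ⟨i, rfl⟩)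
    · rw [hC, sub_self]; exact Ideal.zero_mem _
    · fin_cases i
      · rw [Fin.zero_eta, h0, sub_self]; exact Ideal.zero_mem _
      · change σ (X 1) - X 1 ∈ _
        rw [hinc1]; exact h1J ((weightedFiltration f ![3, 2, 1]).antitone (by norm_num : 1 ≤ 3) hX0)
      · change σ (X 2) - X 2 ∈ _
        rw [hinc2]; exact h1J ((weightedFiltration f ![3, 2, 1]).antitone (by norm_num : 1 ≤ 2) hX1)
      · change σ (X 3) - X 3 ∈ _
        rw [hinc3]; exact h1J hX2
  · rw [hf0, h0, sub_self]; exact Ideal.zero_mem _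
  · -- isolation: `x₀, x₁, x₂` are increments
    refine ⟨1, ?_⟩
    rw [pow_one, Ideal.span_le]
    rintro _ ⟨i, rfl⟩
    rw [SetLike.mem_coe, Ideal.mem_colon_span_singleton, mul_one]
    fin_cases i
    · change f 0 ∈ _
      rw [hf0, ← one_mul (X 0 : MvPolynomial (Fin 4) k), ← hinc1]; exact sub_mem_augmentationIdeal σ _
    · change f 1 ∈ _
      rw [hf1, ← one_mul (X 1 : MvPolynomial (Fin 4) k), ← hinc2]; exact sub_mem_augmentationIdeal σ _
    · change f 2 ∈ _
      rw [hf2, ← one_mul (X 2 : MvPolynomial (Fin 4) k), ← hinc3]; exact sub_mem_augmentationIdeal σ _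
  · rw [hf1, hf0, hinc1, mul_one, sub_self]; exact Ideal.zero_mem _
  · rw [hf2, hf1, hinc2, mul_one, sub_self]; exact Ideal.zero_mem _
  · rw [hf2, hinc3, mul_one, sub_self]; exact Ideal.zero_mem _

/-- **… so the Jordan block with ITS OWN automorphism inhabits `RingKillData`** (non-vacuity by `exists_jordanAut`). [OURS · L1 W4.5c] -/
theorem exists_ringKillData_jordanBlockFour (p : ℕ) (r : Fin 0 → ℕ)
    (𝒜 : (Π j : Fin 0, ZMod (r j)) → AddSubgroup (MvPolynomial (Fin 4) k)) [GradedRing 𝒜] (h𝒜 : ∀ i, 𝒜 i = ⊤) :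
    ∃ σ : MvPolynomial (Fin 4) k ≃+* MvPolynomial (Fin 4) k,
      σ (X 0) = X 0 ∧ σ (X 1) = X 1 + X 0 ∧ σ (X 2) = X 2 + X 1 ∧ σ (X 3) = X 3 + X 2 ∧
        RingKillData p r (MvPolynomial (Fin 4) k) 𝒜 σ := by
  obtain ⟨σ, hC, h0, h1, h2, h3⟩ := exists_jordanAut k
  exact ⟨σ, h0, h1, h2, h3, ringKillData_jordanBlockFour k p r 𝒜 h𝒜 σ hC h0 h1 h2 h3⟩

end JordanFour

end Summit.ResolutionOfSingularities.ResolutionOfSingularities.Theorems.WildQuotientResolution.S1.KillCert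

end
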